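import Literature.Geometry.Riemannian.MetricLinePath
import Literature.Geometry.Riemannian.RoundSphere
import Literature.Geometry.Lorentzian.IsometryProofs
import Mathlib.Geometry.Manifold.Instances.Icc
import HarnessLib

/-!
# The objects of Shi–Wang–Wei's PSC collar (Lemma 2.1): the path `γ_t`, the metric `dt²`, and
# the quasi-spherical cylinder metric `u² dt² + γ_t` on `Σ × [0, 1]`

Topic `Literature/Geometry/Riemannian`; companion of `BoundaryMetricExtension.lean` (the named
fact `ShiWangWei2022_boundaryMetric_extends_psc`, Shi–Wang–Wei, J. reine angew. Math. 784 (2022),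
Thm. 1.1) and `BoundaryMetricExtensionProofs.lean` (step (1) of its printed proof). Step (2) of
that proof is the PSC-cobordism of **Lemma 2.1** (ibid. §2 = arXiv:2007.06756, pp. 6–7):
"Set `γ_t = (1-t)γ₀ + tγ₁`. Then `{γ_t}_{t∈[0,1]}` is a smooth path of metrics on `Σ`. Set
`Ω = Σ × [0,1]`. On `Ω`, define `ḡ = dt² + γ_t` … For a smooth positive function `u` on `Ω`, let
`g = u² dt² + γ_t`" (Claim 2.1), whose scalar curvature Claim 2.1 computes and whose lapse `u`
Claim 2.2 produces by a quasi-spherical parabolic equation. This file builds these OBJECTS as real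
definitions over the tree's `PseudoRiemannianMetric` (no named facts; the curvature identities of
Claims 2.1–2.2 are NOT here):

* (in `MetricLinePath.lean`, imported) `PseudoRiemannianMetric.linePath g₀ g₁ … t` — the path
  `γ_t = (1 - t) γ₀ + t γ₁`, `t ∈ [0, 1]` (`conicComb` with `a = 1 - t`, `b = t`), with
  `γ_0 = γ₀`, `γ_1 = γ₁`, `γ_t - γ_s = (t - s)(γ₁ - γ₀)` and monotonicity.
* `intervalMetric x y` — the metric `dt²` on the segment `[x, y]` (Mathlib's manifold
  `Set.Icc x y`, model `𝓡∂ 1`): the metric induced from the Euclidean metric of `ℝ` by the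
  inclusion, which is a spacelike immersion (`isSpacelikeImmersion_subtype_val_Icc`; Mathlib's
  `mfderiv_subtype_coe_Icc_one`); `dt²(1, 1) = 1` for Mathlib's unit tangent vector `1`.
* `lapseCylinderMetric γ₀ γ₁ … u …` — **the metric `u² dt² + γ_t` on the cylinder `Σ × [0, 1]`**
  (product model `I_Σ.prod (𝓡∂ 1)`): value
  `(1 - t) pr₁^*γ₀ + t pr₁^*γ₁ + u² pr₂^*dt²` (`lapseCylinderMetric_apply`), Riemannian for
  Riemannian `γ₀, γ₁` and a nowhere-vanishing smooth lapse `u` (`ḡ` is `u ≡ 1`); its restriction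
  to the slice `Σ × {t}` is `γ_t` (`pullbackBilin_cylinderSlice_lapseCylinderMetric`), in
  particular `γ₀` on `Σ × {0}` and `γ₁` on `Σ × {1}` — condition (2) of Definition 2.1
  (PSC-cobordism) for the induced metrics; horizontal and vertical vectors are orthogonal and
  `g(∂_t, ∂_t) = u²` (`lapseCylinderMetric_apply_inl_inr`, `…_inr_inr`), so `ν = u⁻¹ ∂_t` is the
  unit normal of the slices as in the proof of Claim 2.1.

Re-charting the cylinder on the half-space model `𝓡∂ (m + 3)` (as the fact's `X` requires) is the
business of `Literature/Topology/FourManifolds/CylinderCobordism.lean` and is not repeated here.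

## References

* Y. Shi, W. Wang, G. Wei, *Total mean curvature of the boundary and nonnegative scalar curvature
  fill-ins*, J. reine angew. Math. 784 (2022) 215–250 = arXiv:2007.06756, §2: Def. 2.1,
  Lemma 2.1 and its proof, Claim 2.1. [ShiWangWei2022]
* B. O'Neill, *Semi-Riemannian geometry with applications to relativity* (1983), Ch. 3, Def. 3.1,
  Lemma 3.5 (metric tensors, products), Ch. 4, p. 97 (induced metrics). [ONeill1983]
-/

noncomputable section

open Bundle Set Function
open scoped Manifold ContDiff Topology RealInnerProductSpace

namespace Literature.Geometry.Riemannian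

open Lorentzian Lorentzian.PseudoRiemannianMetric

/-! ### The metric `dt²` of a segment -/

section Interval

variable (x y : ℝ) [hxy : Fact (x < y)]

/-- Mathlib's unit tangent vector `1 ∈ T_z [x, y]` is nonzero: its image under the differential
of the inclusion `[x, y] → ℝ` is `1` (`mfderiv_subtype_coe_Icc_one`). [folklore] -/
theorem one_tangentSpace_Icc_ne_zero (z : Icc x y) : (1 : TangentSpace (𝓡∂ 1) z) ≠ 0 := by
  intro h
  have h1 := mfderiv_subtype_coe_Icc_one z
  rw [h, map_zero] at h1
  have h1' : (0 : ℝ) = 1 := h1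
  exact zero_ne_one h1'

/-- Every tangent vector of the segment is a multiple of the unit vector `1` (the tangent spaces
are one-dimensional). [folklore] -/
theorem exists_smul_one_tangentSpace_Icc (z : Icc x y) (v : TangentSpace (𝓡∂ 1) z) :
    ∃ c : ℝ, c • (1 : TangentSpace (𝓡∂ 1) z) = v := by
  have hrank : Module.finrank ℝ (TangentSpace (𝓡∂ 1) z) = 1 := finrank_euclideanSpace_fin
  exact (finrank_eq_one_iff_of_nonzero' (1 : TangentSpace (𝓡∂ 1) z)
    (one_tangentSpace_Icc_ne_zero x y z)).1 hrank v

/-- The differential of the inclusion `[x, y] → ℝ` on a tangent vector `c • 1` is `c`.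
[folklore] -/
theorem mfderiv_subtype_val_Icc_smul_one (z : Icc x y) (c : ℝ) :
    mfderiv (𝓡∂ 1) 𝓘(ℝ) (Subtype.val : Icc x y → ℝ) z (c • (1 : TangentSpace (𝓡∂ 1) z)) =
      c := by
  rw [map_smul, mfderiv_subtype_coe_Icc_one]
  show c * (1 : ℝ) = c
  rw [mul_one]

/-- **The inclusion of a segment into the line is a spacelike immersion** for the Euclidean
metric of `ℝ`: it is `C^∞` (Mathlib's `contMDiff_subtype_coe_Icc`) and its differential is
injective (`d(val)(c • 1) = c`). [folklore] -/
theorem isSpacelikeImmersion_subtype_val_Icc :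
    (euclideanMetric ℝ).IsSpacelikeImmersion (𝓡∂ 1) (Subtype.val : Icc x y → ℝ) := by
  refine ⟨contMDiff_subtype_coe_Icc, fun z v hv ↦ ?_⟩
  obtain ⟨c, rfl⟩ := exists_smul_one_tangentSpace_Icc x y z v
  have hc : c ≠ 0 := fun h ↦ hv (by rw [h, zero_smul])
  rw [inducedBilin_apply, euclideanMetric_apply, mfderiv_subtype_val_Icc_smul_one]
  exact real_inner_self_pos.mpr hc

/-- **The metric `dt²` on the segment `[x, y]`**: the metric induced on Mathlib's manifold
`Set.Icc x y` (model `𝓡∂ 1`) from the Euclidean metric of `ℝ` by the inclusion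
(`PseudoRiemannianMetric.inducedMetric`; smoothness by `contMDiff_pullbackBilin_holds`). This is
the factor `dt²` of `ḡ = dt² + γ_t` in Shi–Wang–Wei 2022, Claim 2.1 / proof of Lemma 2.1; O'Neill
1983, Ch. 3, p. 55 and Ch. 4, p. 97. [folklore] -/
def intervalMetric : PseudoRiemannianMetric (𝓡∂ 1) ∞ (EuclideanSpace ℝ (Fin 1))
    (TangentSpace (𝓡∂ 1) : Icc x y → Type _) :=
  (euclideanMetric ℝ).inducedMetric (Subtype.val : Icc x y → ℝ) contMDiff_pullbackBilin_holds
    (isSpacelikeImmersion_subtype_val_Icc x y)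

/-- `dt²(v, w) = ⟪d(val) v, d(val) w⟫`. [folklore] -/
theorem intervalMetric_apply (z : Icc x y) (v w : TangentSpace (𝓡∂ 1) z) :
    (intervalMetric x y).val z v w =
      ⟪(mfderiv (𝓡∂ 1) 𝓘(ℝ) (Subtype.val : Icc x y → ℝ) z v : ℝ),
        (mfderiv (𝓡∂ 1) 𝓘(ℝ) (Subtype.val : Icc x y → ℝ) z w : ℝ)⟫ := by
  rw [← euclideanMetric_apply]
  rfl

/-- `dt²(a • 1, b • 1) = a b`; in particular `dt²(1, 1) = 1`. [folklore] -/
theorem intervalMetric_apply_smul_one (z : Icc x y) (a b : ℝ) :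
    (intervalMetric x y).val z (a • (1 : TangentSpace (𝓡∂ 1) z)) (b • 1) = a * b := by
  rw [intervalMetric_apply, mfderiv_subtype_val_Icc_smul_one, mfderiv_subtype_val_Icc_smul_one]
  exact Real.inner_apply a b

/-- `dt²(1, 1) = 1`. [folklore] -/
theorem intervalMetric_apply_one_one (z : Icc x y) :
    (intervalMetric x y).val z (1 : TangentSpace (𝓡∂ 1) z) 1 = 1 := by
  simpa using intervalMetric_apply_smul_one x y z 1 1

/-- `dt²` is Riemannian. [folklore] -/
theorem isRiemannian_intervalMetric : (intervalMetric x y).IsRiemannian :=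
  isRiemannian_inducedMetric _ _ contMDiff_pullbackBilin_holds
    (isSpacelikeImmersion_subtype_val_Icc x y)

end Interval

/-! ### The quasi-spherical cylinder metric `u² dt² + γ_t` on `Σ × [0, 1]` -/

section Slice

variable {S : Type*}

/-- The embedding of the slice `Σ × {t}` of the cylinder `Σ × [0, 1]`: `z ↦ (z, t)`.
[cite: ShiWangWei2022, Claim 2.1] -/
def cylinderSlice (t : Icc (0 : ℝ) 1) (z : S) : S × Icc (0 : ℝ) 1 := (z, t)

/-- `cylinderSlice t z = (z, t)`. [folklore] -/
@[simp] theorem cylinderSlice_apply (t : Icc (0 : ℝ) 1) (z : S) : cylinderSlice t z = (z, t) := rfl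

end Slice

section Cylinder

variable {ES : Type*} [NormedAddCommGroup ES] [NormedSpace ℝ ES] {HS : Type*}
  [TopologicalSpace HS] {IS : ModelWithCorners ℝ ES HS} {S : Type*} [TopologicalSpace S]
  [ChartedSpace HS S] [IsManifold IS ∞ S]

/-- The bilinear form `(1 - t) pr₁^*γ₀ + t pr₁^*γ₁ + u² pr₂^*dt²` at a point `p = (z, t)` of the
cylinder `Σ × [0, 1]` (pullbacks `pullbackBilin` along the two projections). [cite: ShiWangWei2022, Claim 2.1] -/
def lapseCylinderBilin (γ₀ γ₁ : PseudoRiemannianMetric IS ∞ ES (TangentSpace IS : S → Type _))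
    (u : S × Icc (0 : ℝ) 1 → ℝ) (p : S × Icc (0 : ℝ) 1) :
    TangentSpace (IS.prod (𝓡∂ 1)) p →L[ℝ] TangentSpace (IS.prod (𝓡∂ 1)) p →L[ℝ] ℝ :=
  (1 - (p.2 : ℝ)) • pullbackBilin (I := IS) (I' := IS.prod (𝓡∂ 1)) Prod.fst γ₀.val p +
    (p.2 : ℝ) • pullbackBilin (I := IS) (I' := IS.prod (𝓡∂ 1)) Prod.fst γ₁.val p +
    u p ^ 2 • pullbackBilin (I := 𝓡∂ 1) (I' := IS.prod (𝓡∂ 1)) Prod.snd (intervalMetric 0 1).val p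

variable (γ₀ γ₁ : PseudoRiemannianMetric IS ∞ ES (TangentSpace IS : S → Type _))
  (u : S × Icc (0 : ℝ) 1 → ℝ)

/-- **`(u² dt² + γ_t)((v, a), (w, b)) = (1 - t) γ₀(v, w) + t γ₁(v, w) + u² dt²(a, b)`** at
`(z, t)`, for tangent vectors of the cylinder split as `T_{(z,t)} (Σ × [0,1]) = T_z Σ × T_t [0,1]`
(Mathlib's `mfderiv_fst`, `mfderiv_snd`). [cite: ShiWangWei2022, Claim 2.1] -/
theorem lapseCylinderBilin_apply (p : S × Icc (0 : ℝ) 1)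
    (v w : TangentSpace (IS.prod (𝓡∂ 1)) p) :
    lapseCylinderBilin γ₀ γ₁ u p v w =
      (1 - (p.2 : ℝ)) * γ₀.val p.1 v.1 w.1 + (p.2 : ℝ) * γ₁.val p.1 v.1 w.1 +
        u p ^ 2 * (intervalMetric 0 1).val p.2 v.2 w.2 := by
  obtain ⟨z, t⟩ := p
  simp only [lapseCylinderBilin, add_apply, FunLike.coe_smul, Pi.smul_apply,
    smul_eq_mul, pullbackBilin_apply]
  rw [mfderiv_fst, mfderiv_snd]
  rfl

/-- **The quasi-spherical cylinder metric `u² dt² + γ_t` on `Ω = Σ × [0, 1]`** of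
Shi–Wang–Wei 2022, Claim 2.1 and proof of Lemma 2.1 (`γ_t = (1 - t) γ₀ + t γ₁`; `ḡ = dt² + γ_t`
is the case `u ≡ 1`): a `C^∞` Riemannian pseudo-Riemannian metric on the product manifold
`Σ × [0, 1]` (model `I_Σ.prod (𝓡∂ 1)`), for Riemannian `C^∞` metrics `γ₀`, `γ₁` on `Σ` and a
smooth nowhere-vanishing lapse `u`. Nondegeneracy is positive definiteness (fibrewise, from the
product splitting); smoothness: the three pullbacks are `C^∞` (`contMDiff_pullbackBilin_holds`
along `pr₁`, `pr₂`), the coefficients `1 - t`, `t` (`contMDiff_subtype_coe_Icc`) and `u²` are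
`C^∞`, and `ContMDiff.smul_section` / `add_section`. [cite: ShiWangWei2022, Claim 2.1 and proof of Lemma 2.1] -/
def lapseCylinderMetric (h₀ : γ₀.IsRiemannian) (h₁ : γ₁.IsRiemannian)
    (hu : ContMDiff (IS.prod (𝓡∂ 1)) 𝓘(ℝ) ∞ u) (hu0 : ∀ p, u p ≠ 0) :
    PseudoRiemannianMetric (IS.prod (𝓡∂ 1)) ∞ (ES × EuclideanSpace ℝ (Fin 1))
      (TangentSpace (IS.prod (𝓡∂ 1)) : S × Icc (0 : ℝ) 1 → Type _) where
  val := lapseCylinderBilin γ₀ γ₁ u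
  symm p v w := by
    rw [lapseCylinderBilin_apply, lapseCylinderBilin_apply, γ₀.symm, γ₁.symm,
      (intervalMetric 0 1).symm]
  nondegenerate p v hv := by
    by_contra hne
    have ht0 : 0 ≤ 1 - (p.2 : ℝ) := sub_nonneg.2 p.2.2.2
    have ht1 : 0 ≤ (p.2 : ℝ) := p.2.2.1
    have hq0 : 0 ≤ γ₀.val p.1 v.1 v.1 := by
      by_cases h : v.1 = 0
      · have h0 : γ₀.val p.1 v.1 v.1 = 0 := by rw [h]; exact (γ₀.val p.1 0).map_zero
        exact h0.ge
      · exact (h₀ p.1 v.1 h).le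
    have hq1 : 0 ≤ γ₁.val p.1 v.1 v.1 := by
      by_cases h : v.1 = 0
      · have h0 : γ₁.val p.1 v.1 v.1 = 0 := by rw [h]; exact (γ₁.val p.1 0).map_zero
        exact h0.ge
      · exact (h₁ p.1 v.1 h).le
    have hq2 : 0 ≤ (intervalMetric 0 1).val p.2 v.2 v.2 := by
      by_cases h : v.2 = 0
      · have h0 : (intervalMetric 0 1).val p.2 v.2 v.2 = 0 := by
          rw [h]; exact ((intervalMetric 0 1).val p.2 0).map_zero
        exact h0.ge
      · exact (isRiemannian_intervalMetric 0 1 p.2 v.2 h).le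
    have hsum : (1 - (p.2 : ℝ)) * γ₀.val p.1 v.1 v.1 + (p.2 : ℝ) * γ₁.val p.1 v.1 v.1 +
        u p ^ 2 * (intervalMetric 0 1).val p.2 v.2 v.2 = 0 := by
      rw [← lapseCylinderBilin_apply]; exact hv v
    have hpos : 0 < (1 - (p.2 : ℝ)) * γ₀.val p.1 v.1 v.1 + (p.2 : ℝ) * γ₁.val p.1 v.1 v.1 +
        u p ^ 2 * (intervalMetric 0 1).val p.2 v.2 v.2 := by
      by_cases h1 : v.1 = 0
      · have h2 : v.2 ≠ 0 := fun h2 ↦ hne (Prod.ext h1 h2)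
        have hp2 : 0 < (intervalMetric 0 1).val p.2 v.2 v.2 :=
          isRiemannian_intervalMetric 0 1 p.2 v.2 h2
        have hu2 : 0 < u p ^ 2 := sq_pos_iff.mpr (hu0 p)
        exact add_pos_of_nonneg_of_pos (add_nonneg (mul_nonneg ht0 hq0) (mul_nonneg ht1 hq1))
          (mul_pos hu2 hp2)
      · have ha := h₀ p.1 v.1 h1
        have hb := h₁ p.1 v.1 h1
        have hmin : min (γ₀.val p.1 v.1 v.1) (γ₁.val p.1 v.1 v.1) ≤
            (1 - (p.2 : ℝ)) * γ₀.val p.1 v.1 v.1 + (p.2 : ℝ) * γ₁.val p.1 v.1 v.1 := by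
          nlinarith [min_le_left (γ₀.val p.1 v.1 v.1) (γ₁.val p.1 v.1 v.1),
            min_le_right (γ₀.val p.1 v.1 v.1) (γ₁.val p.1 v.1 v.1)]
        have hm : 0 < min (γ₀.val p.1 v.1 v.1) (γ₁.val p.1 v.1 v.1) := lt_min ha hb
        exact add_pos_of_pos_of_nonneg (hm.trans_le hmin) (mul_nonneg (sq_nonneg _) hq2)
    exact hpos.ne' hsum
  contMDiff := by
    have hτ : ContMDiff (IS.prod (𝓡∂ 1)) 𝓘(ℝ) ∞ (fun p : S × Icc (0 : ℝ) 1 ↦ (p.2 : ℝ)) :=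
      contMDiff_subtype_coe_Icc.comp contMDiff_snd
    have hγ₀ := contMDiff_pullbackBilin_holds (I := IS) (I' := IS.prod (𝓡∂ 1)) (M := S)
      (N := S × Icc (0 : ℝ) 1) (n := ∞) (Prod.fst : S × Icc (0 : ℝ) 1 → S) contMDiff_fst γ₀
    have hγ₁ := contMDiff_pullbackBilin_holds (I := IS) (I' := IS.prod (𝓡∂ 1)) (M := S)
      (N := S × Icc (0 : ℝ) 1) (n := ∞) (Prod.fst : S × Icc (0 : ℝ) 1 → S) contMDiff_fst γ₁
    have hdt := contMDiff_pullbackBilin_holds (I := 𝓡∂ 1) (I' := IS.prod (𝓡∂ 1))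
      (M := Icc (0 : ℝ) 1) (N := S × Icc (0 : ℝ) 1) (n := ∞)
      (Prod.snd : S × Icc (0 : ℝ) 1 → Icc (0 : ℝ) 1) contMDiff_snd (intervalMetric 0 1)
    have hτ' : ContMDiff (IS.prod (𝓡∂ 1)) 𝓘(ℝ) ∞ (fun p : S × Icc (0 : ℝ) 1 ↦ 1 - (p.2 : ℝ)) :=
      (contDiff_const.sub contDiff_id).comp_contMDiff hτ
    have hu2 : ContMDiff (IS.prod (𝓡∂ 1)) 𝓘(ℝ) ∞ (fun p : S × Icc (0 : ℝ) 1 ↦ u p ^ 2) :=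
      (contDiff_id.pow 2).comp_contMDiff hu
    exact ((hτ'.smul_section hγ₀).add_section (hτ.smul_section hγ₁)).add_section
      (hu2.smul_section hdt)

/-- The value of the cylinder metric:
`(u² dt² + γ_t)((v, a), (w, b)) = (1 - t) γ₀(v, w) + t γ₁(v, w) + u² dt²(a, b)`.
[cite: ShiWangWei2022, Claim 2.1] -/
theorem lapseCylinderMetric_apply (h₀ : γ₀.IsRiemannian) (h₁ : γ₁.IsRiemannian)
    (hu : ContMDiff (IS.prod (𝓡∂ 1)) 𝓘(ℝ) ∞ u) (hu0 : ∀ p, u p ≠ 0) (p : S × Icc (0 : ℝ) 1)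
    (v w : TangentSpace (IS.prod (𝓡∂ 1)) p) :
    (lapseCylinderMetric γ₀ γ₁ u h₀ h₁ hu hu0).val p v w =
      (1 - (p.2 : ℝ)) * γ₀.val p.1 v.1 w.1 + (p.2 : ℝ) * γ₁.val p.1 v.1 w.1 +
        u p ^ 2 * (intervalMetric 0 1).val p.2 v.2 w.2 :=
  lapseCylinderBilin_apply γ₀ γ₁ u p v w

/-- **`u² dt² + γ_t` is Riemannian** (for Riemannian `γ₀, γ₁` and a nowhere-vanishing lapse).
[cite: ShiWangWei2022, Claim 2.1] -/
theorem isRiemannian_lapseCylinderMetric (h₀ : γ₀.IsRiemannian) (h₁ : γ₁.IsRiemannian)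
    (hu : ContMDiff (IS.prod (𝓡∂ 1)) 𝓘(ℝ) ∞ u) (hu0 : ∀ p, u p ≠ 0) :
    (lapseCylinderMetric γ₀ γ₁ u h₀ h₁ hu hu0).IsRiemannian := by
  intro p v hv
  -- nondegeneracy was proved through positivity; re-run the positivity argument
  rw [lapseCylinderMetric_apply]
  have ht0 : 0 ≤ 1 - (p.2 : ℝ) := sub_nonneg.2 p.2.2.2
  have ht1 : 0 ≤ (p.2 : ℝ) := p.2.2.1
  have hq0 : 0 ≤ γ₀.val p.1 v.1 v.1 := by
    by_cases h : v.1 = 0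
    · have h0 : γ₀.val p.1 v.1 v.1 = 0 := by rw [h]; exact (γ₀.val p.1 0).map_zero
      exact h0.ge
    · exact (h₀ p.1 v.1 h).le
  have hq1 : 0 ≤ γ₁.val p.1 v.1 v.1 := by
    by_cases h : v.1 = 0
    · have h0 : γ₁.val p.1 v.1 v.1 = 0 := by rw [h]; exact (γ₁.val p.1 0).map_zero
      exact h0.ge
    · exact (h₁ p.1 v.1 h).le
  have hq2 : 0 ≤ (intervalMetric 0 1).val p.2 v.2 v.2 := by
    by_cases h : v.2 = 0
    · have h0 : (intervalMetric 0 1).val p.2 v.2 v.2 = 0 := by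
        rw [h]; exact ((intervalMetric 0 1).val p.2 0).map_zero
      exact h0.ge
    · exact (isRiemannian_intervalMetric 0 1 p.2 v.2 h).le
  by_cases h1 : v.1 = 0
  · have h2 : v.2 ≠ 0 := fun h2 ↦ hv (Prod.ext h1 h2)
    have hp2 : 0 < (intervalMetric 0 1).val p.2 v.2 v.2 :=
      isRiemannian_intervalMetric 0 1 p.2 v.2 h2
    have hu2 : 0 < u p ^ 2 := sq_pos_iff.mpr (hu0 p)
    exact add_pos_of_nonneg_of_pos (add_nonneg (mul_nonneg ht0 hq0) (mul_nonneg ht1 hq1))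
      (mul_pos hu2 hp2)
  · have ha := h₀ p.1 v.1 h1
    have hb := h₁ p.1 v.1 h1
    have hmin : min (γ₀.val p.1 v.1 v.1) (γ₁.val p.1 v.1 v.1) ≤
        (1 - (p.2 : ℝ)) * γ₀.val p.1 v.1 v.1 + (p.2 : ℝ) * γ₁.val p.1 v.1 v.1 := by
      nlinarith [min_le_left (γ₀.val p.1 v.1 v.1) (γ₁.val p.1 v.1 v.1),
        min_le_right (γ₀.val p.1 v.1 v.1) (γ₁.val p.1 v.1 v.1)]
    have hm : 0 < min (γ₀.val p.1 v.1 v.1) (γ₁.val p.1 v.1 v.1) := lt_min ha hb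
    exact add_pos_of_pos_of_nonneg (hm.trans_le hmin) (mul_nonneg (sq_nonneg _) hq2)

/-- **Horizontal and vertical vectors are orthogonal**: `(u² dt² + γ_t)((v, 0), (0, b)) = 0` — the
slices `Σ × {t}` are orthogonal to `∂_t`, so `u⁻¹ ∂_t` is the unit normal of the slices
(`lapseCylinderMetric_apply_inr_inr`). [cite: ShiWangWei2022, Claim 2.1] -/
theorem lapseCylinderMetric_apply_inl_inr (h₀ : γ₀.IsRiemannian) (h₁ : γ₁.IsRiemannian)
    (hu : ContMDiff (IS.prod (𝓡∂ 1)) 𝓘(ℝ) ∞ u) (hu0 : ∀ p, u p ≠ 0) (p : S × Icc (0 : ℝ) 1)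
    (v : TangentSpace IS p.1) (b : TangentSpace (𝓡∂ 1) p.2) :
    (lapseCylinderMetric γ₀ γ₁ u h₀ h₁ hu hu0).val p
      ((v, 0) : TangentSpace (IS.prod (𝓡∂ 1)) p) ((0, b) : TangentSpace (IS.prod (𝓡∂ 1)) p) =
      0 := by
  rw [lapseCylinderMetric_apply]
  show (1 - (p.2 : ℝ)) * γ₀.val p.1 v 0 + (p.2 : ℝ) * γ₁.val p.1 v 0 +
    u p ^ 2 * (intervalMetric 0 1).val p.2 0 b = 0
  rw [(γ₀.val p.1 v).map_zero, (γ₁.val p.1 v).map_zero, ((intervalMetric 0 1).val p.2).map_zero,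
    zero_apply]
  ring

/-- **The lapse**: on vertical vectors `(u² dt² + γ_t)((0, a·1), (0, b·1)) = u² a b`, i.e.
`g(∂_t, ∂_t) = u²` — `u` is the length of `∂_t` and `ν = u⁻¹ ∂_t` the unit normal of the slices
("where `ν = u⁻¹ ∂_t`", proof of Claim 2.1). [cite: ShiWangWei2022, Claim 2.1] -/
theorem lapseCylinderMetric_apply_inr_inr (h₀ : γ₀.IsRiemannian) (h₁ : γ₁.IsRiemannian)
    (hu : ContMDiff (IS.prod (𝓡∂ 1)) 𝓘(ℝ) ∞ u) (hu0 : ∀ p, u p ≠ 0) (p : S × Icc (0 : ℝ) 1)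
    (a b : ℝ) :
    (lapseCylinderMetric γ₀ γ₁ u h₀ h₁ hu hu0).val p
      ((0, a • (1 : TangentSpace (𝓡∂ 1) p.2)) : TangentSpace (IS.prod (𝓡∂ 1)) p)
      ((0, b • (1 : TangentSpace (𝓡∂ 1) p.2)) : TangentSpace (IS.prod (𝓡∂ 1)) p) =
      u p ^ 2 * (a * b) := by
  rw [lapseCylinderMetric_apply]
  show (1 - (p.2 : ℝ)) * γ₀.val p.1 0 0 + (p.2 : ℝ) * γ₁.val p.1 0 0 +
    u p ^ 2 * (intervalMetric 0 1).val p.2 (a • 1) (b • 1) = u p ^ 2 * (a * b)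
  rw [(γ₀.val p.1).map_zero, (γ₁.val p.1).map_zero, zero_apply,
    intervalMetric_apply_smul_one]
  ring

/-- **The metric induced on the slice `Σ × {t}` is `γ_t = (1 - t) γ₀ + t γ₁`**: the pullback of
`u² dt² + γ_t` along `z ↦ (z, t)` is `PseudoRiemannianMetric.linePath γ₀ γ₁ t` (the differential
of the slice embedding is `v ↦ (v, 0)`, Mathlib's `mfderiv_prod_left`). This is "the induced
metric on `Σ_t`" of Claim 2.1 and, at `t = 0, 1`, condition (2) of Definition 2.1 for the
induced metrics (`pullbackBilin_cylinderSlice_zero/one`). [cite: ShiWangWei2022, Claim 2.1 and Def. 2.1] -/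
theorem pullbackBilin_cylinderSlice_lapseCylinderMetric (h₀ : γ₀.IsRiemannian)
    (h₁ : γ₁.IsRiemannian) (hu : ContMDiff (IS.prod (𝓡∂ 1)) 𝓘(ℝ) ∞ u) (hu0 : ∀ p, u p ≠ 0)
    (t : Icc (0 : ℝ) 1) (z : S) (v w : TangentSpace IS z) :
    pullbackBilin (I := IS.prod (𝓡∂ 1)) (I' := IS) (cylinderSlice t)
        (lapseCylinderMetric γ₀ γ₁ u h₀ h₁ hu hu0).val z v w =
      (γ₀.linePath γ₁ h₀ h₁ t t.2).val z v w := by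
  rw [pullbackBilin_apply, linePath_apply]
  have hd : mfderiv IS (IS.prod (𝓡∂ 1)) (cylinderSlice (S := S) t) z =
      ContinuousLinearMap.inl ℝ (TangentSpace IS z) (TangentSpace (𝓡∂ 1) t) :=
    mfderiv_prod_left
  rw [hd]
  show (lapseCylinderMetric γ₀ γ₁ u h₀ h₁ hu hu0).val (z, t)
      ((v, 0) : TangentSpace (IS.prod (𝓡∂ 1)) (z, t))
      ((w, 0) : TangentSpace (IS.prod (𝓡∂ 1)) (z, t)) = _
  rw [lapseCylinderMetric_apply]
  show (1 - (t : ℝ)) * γ₀.val z v w + (t : ℝ) * γ₁.val z v w +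
    u (z, t) ^ 2 * (intervalMetric 0 1).val t 0 0 = _
  rw [((intervalMetric 0 1).val t).map_zero, zero_apply, mul_zero, add_zero]

/-- **The metric induced on `Σ × {0}` is `γ₀`.** [cite: ShiWangWei2022, Def. 2.1 (2) and proof of Lemma 2.1] -/
theorem pullbackBilin_cylinderSlice_zero (h₀ : γ₀.IsRiemannian) (h₁ : γ₁.IsRiemannian)
    (hu : ContMDiff (IS.prod (𝓡∂ 1)) 𝓘(ℝ) ∞ u) (hu0 : ∀ p, u p ≠ 0) (z : S)
    (v w : TangentSpace IS z) :
    pullbackBilin (I := IS.prod (𝓡∂ 1)) (I' := IS) (cylinderSlice ⟨0, le_rfl, zero_le_one⟩)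
        (lapseCylinderMetric γ₀ γ₁ u h₀ h₁ hu hu0).val z v w = γ₀.val z v w := by
  rw [pullbackBilin_cylinderSlice_lapseCylinderMetric, linePath_apply]
  simp

/-- **The metric induced on `Σ × {1}` is `γ₁`.** [cite: ShiWangWei2022, Def. 2.1 (2) and proof of Lemma 2.1] -/
theorem pullbackBilin_cylinderSlice_one (h₀ : γ₀.IsRiemannian) (h₁ : γ₁.IsRiemannian)
    (hu : ContMDiff (IS.prod (𝓡∂ 1)) 𝓘(ℝ) ∞ u) (hu0 : ∀ p, u p ≠ 0) (z : S)
    (v w : TangentSpace IS z) :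
    pullbackBilin (I := IS.prod (𝓡∂ 1)) (I' := IS) (cylinderSlice ⟨1, zero_le_one, le_rfl⟩)
        (lapseCylinderMetric γ₀ γ₁ u h₀ h₁ hu hu0).val z v w = γ₁.val z v w := by
  rw [pullbackBilin_cylinderSlice_lapseCylinderMetric, linePath_apply]
  simp

end Cylinder

end Literature.Geometry.Riemannian

end
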